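import Summits.BirchSwinnertonDyer.BirchSwinnertonDyer.Theses.UniversalToricDescent
import Summits.BirchSwinnertonDyer.BirchSwinnertonDyer.Theorems.UniversalToricDescentTwinAlgMuZeroAtThreeOfBetaRoadParam
import Summits.BirchSwinnertonDyer.BirchSwinnertonDyer.Theorems.UniversalToricDescentTwinAlgMuZeroAtThreeOfBuckets
import Summits.BirchSwinnertonDyer.BirchSwinnertonDyer.Theorems.UniversalToricDescentAcDualMuZeroCriterion
import HarnessLib

/-!
# Crux 24737 `TwinAlgMuZeroAtThree` — NODE `schur_promodular_eisenstein_radical` (crux-ideate g7, idea `schur-promodular-eisenstein-radical`)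

D-0171 node for `stmt-BirchSwinnertonDyer-24737` (NOT registered; the registered skeleton of record stays `Lines/beta_road.lean` v19,
sha16 `4b5d40f4a458397e`).  Companion cards: `Ideas/schur-promodular-eisenstein-radical.md` (crux idea), `Lines/schur_promodular_eisenstein_radical.md`
(node card with the children E1–E5 and their tags).

## Thesis of the node (bucket B; bucket C₀ stays the registered constant `stub_goodSS` BY NAME)

The crux asks, for the `3`-adic twin `E′` (bucket B: multiplicative and très ramifié at `3`; bucket C₀: good supersingular with `a₃ = 0`)
over the anticyclotomic tower of a Heegner field `K` with `d_K` odd, that Castella's compact `(∅,0)`-Selmer module `X = X_(∅,0)(E′/K_∞)`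
at `𝔭′` be `Λ`-torsion with algebraic `μ = 0`.  Every live line on this crux (KEEPKILL g2–g6: Heegner/bipartite/flat/Flach/β-road/
two-variable descent) produces a COHOMOLOGY CLASS and bounds `X` from above by it.  This node has NO class.  Its currency is an
ANNIHILATOR: the bucket-B half is re-typed as

  S_E `EisensteinAnnihilatorMultOfParamAtThree`:  «some `g ∈ Λ = ℤ₃⟦T⟧` with `g ∉ 3Λ` kills `X`»,

which is EQUIVALENT to the B-half of the crux (proved here: `isTorsion_and_moduleFinite_of_isTorsionBy_of_not_mem_augIdealP` gives
S_E ⟹ torsion ∧ `X` f.g. over `ℤ₃` ⟹ crux-B through the route receptacle; `eisensteinAnnihilator_of_crux` gives crux ⟹ S_E by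
Cayley–Hamilton on the finitely generated `ℤ₃`-module `X`) — UNDECIDED · EQUIV, hence it carries children (node card §E1–E5):

* **E1** (port · ATTACKABLE/INSTRUMENTABLE) the `Λ^ac`-adic endoscopic/Klingen–Eisenstein eigensystem of `(f_{E′}, K)` on the quasi-split
  unitary group `U(3,1)` (three residual constituents `χ̄₁, ρ̄_{E′}|_K ⊗ ξ̄, χ̄₂`), `3` split in `K`, `E′` STEINBERG hence ORDINARY at `3`, and
  its stable congruence ideal `J^st ⊂ 𝕋^st_𝔪` [cite: Wan2020, Thm. 1.1 (shape; printed for `p` split, `f` ordinary)] [cite: Hsieh2014JAMS, §1 (Eisenstein congruence on unitary groups, shape)];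
* **E2** (THE LEVER · IDEA-NEEDED at `l = 3`) SCHUR PRO-MODULARITY: for every non-split residual class `c ∈ Sel_(∅,0)(K_∞, ρ̄-twist)` the
  Schur representation `σ̄_c` has an ordinary polarized deformation ring `R_c` every irreducible component of which, of dimension `≥ dim Λ`,
  is pro-automorphic and generically irreducible — Thorne/Allen–Newton–Thorne's theorem with their STEINBERG hypothesis replaced by the
  crux's own TORSION conjunct (E4): torsion of the `Λ`-adic `Ext`-module makes the reducible locus `Z_c ⊂ Spec R_c` of dimension `dim Λ − 1`,
  too small to be a component [cite: Thorne2015JAMS, Thm. 7.1 and §1 p. 2 (Steinberg place bounds the reducible locus)]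
  [cite: AllenNewtonThorne2020, Thm. 1.1 and Lemma 3.6] [cite: SkinnerWiles1999, §1 (GL₂ prototype, `p` odd, margin one)];
  PRINT WALL (honest): both sources carry the standing hypothesis «`l > 3` and `l ∤ n`» [cite: AllenNewtonThorne2020, Thm. 1.1 (viii)] —
  at `l = 3`, `n = 4` one has `l ∤ n` but NOT `l > 3`; the uses of `l > 3` (big image in Hida families via Borel–de Siebenthal/Pink over
  `k⟦T⟧`, traces ↦ `Λ^i` of the representation) must be re-done with Chenevier determinants [cite: Chenevier2014Determinants, §1] and
  type-`A₃` group theory in characteristic `3`; moreover the bigness hypothesis «`r̄(G_{F(ζ_l)})` has no quotient of `l`-power order»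
  [cite: Thorne2015JAMS, §5 hypothesis (3), p. 852] FAILS verbatim for `ρ̄_{E′}(G_{K(ζ₃)}) = SL₂(𝔽₃) = Q₈ ⋊ C₃`, while its uses survive
  by hand — `H¹(SL₂(𝔽₃), ad⁰) = 0` (`(ad⁰)^{Q₈} = 0`), `End(V)` is spanned by the eigenprojections of `±i, ±j, ±k`, and
  `K(E′[3]) ∩ K(ζ₉) = K(ζ₃)` (the `C₃`-quotient field is an `S₃`-extension of `ℚ`, not inside `ℚ(ζ₉)`) — the GL₂ situation of Wiles at
  `p = 3`; carrying this into the unitary patching is a finite group-cohomology check (INSTRUMENTABLE) [cite: Thorne2012, §2 (adequacy, shape)];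
* **E3** (UNDECIDED · ATTACKABLE) `Λ`-adic exhaustion ⟹ annihilation up to radical: GMA/pseudo-representation universality over the
  stable Hida–Hecke algebra turns «every height-one point of `Supp(X)` is a stable congruence point» into `√Ann_Λ(X) ⊇ √(J^st·Λ)`
  [cite: BellaicheChenevier2009, Thm. 1.5.5] [cite: WakeWangErickson2021, §1 (pseudo-deformation method, printed for `p > 3`)];
* **E4** (WEAKER · ATTACKABLE) the TORSION conjunct of the crux alone (= `rank_Λ X = 0`; shared with the β-road output K2a‴ and with
  Cornut–Vatsal + Howard at `p ≥ 5`) — consumed by E2 in place of Steinberg;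
* **E5** (UNDECIDED) `μ(J^st) = 0`, i.e. `J^st ⊄ 3Λ`: «the endoscopic eigensystem of `(f_{E′}, K)` is not congruent modulo `3` to a
  STABLE `Λ`-adic eigensystem uniformly in the anticyclotomic variable» — three roads: (a) Rallis inner product for the theta lift
  `U(2)×U(1) → U(3,1)` + Hida's congruence-number bound given `𝔪`-freeness from patching + `μ(L^Σ_𝔭) = 0` = route item
  `TwinHsiehThmBInput` (stmt-20711) BY NAME [cite: Hsieh2014, Thm. B]; loses the congruence number `3^{a(f)}` of `f_{E′}` ⇒ per curve;
  (b) an Ohta-type exact sequence `𝕋^st_𝔪/J^st ↪ Λ/(L^Σ_𝔭·u)` at `p = 3` [cite: Ohta1999, §3 (shape, GL₂)] — IDEA-NEEDED;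
  (c) INSTRUMENTABLE: definite-`U(4)` algebraic modular forms modulo `3` for `(15a1, K = ℚ(√−11))` by lattice methods
  [cite: GreenbergVoight2014, §1] — a finite computation per `(E′, K)` deciding whether the endoscopic system is cuspidal-stable mod `3`.

Assembly inside the node: E1 ∧ E2 ∧ E3 ∧ E4 ⟹ `√Ann(X) ∋` a generator-power of `J^st`; E5 ⟹ that element is `3`-free ⟹ S_E.
WHY EASIER than the crux as typed: the two conjuncts are attacked by DIFFERENT tools neither of which is an Euler/Kolyvagin system at `p = 3`
— torsion (E4) is the weak half every line already reaches, and `μ = 0` becomes a statement about AUTOMORPHIC congruences (E5) with an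
`L`-value handle (Rallis) and a finite-computation handle (definite unitary forms), instead of a divisibility of Heegner classes in
`E′(K_n) ⊗ 𝔽₃` where `TraceZeroHeegnerTowerAtThree` and `EulerSystemBigImageAtSmallImage` bite.

Barriers (catalogue `Literature/Barriers/BirchSwinnertonDyer/`): `NoAdmissiblePrimesAtThree` — not in its class (Taylor–Wiles primes,
no level-raising at admissible primes); `EulerSystemBigImageAtSmallImage` — no Euler system; `TraceZeroHeegnerTower*` — no CM points;
`ExceptionalZeroBarrierNarrow` — `E′` Steinberg at `3` is ordinary and the `(∅,0)` condition has no trivial zero (the BDP-type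
`L^Σ_𝔭` interpolates central values twisted by infinite-order anticyclotomic characters).  Disproof ledger (`Disproof.lean`): the node keeps
every hypothesis of the crux in S_E's binder (Heegner hypothesis and `d_K` odd enter through E1/E5(a) = Hsieh's `μ = 0`), so no
`_false_without_` obstruction is violated; levers (i)/(ii) of Disproof §1 are not used.

## Pieces and tags (D-0171)
* S_E `EisensteinAnnihilatorMultOfParamAtThree` — UNDECIDED · EQUIV to the bucket-B half (both directions kernel-checked below) ⇒ children E1–E5.
* A `isTorsion_and_moduleFinite_of_isTorsionBy_of_not_mem_augIdealP` — WEAKER · PROVED here (pure `Λ`-algebra).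
* C₀′ `stub_goodSS` — the registered constant of `beta_road` v19 BY NAME (untouched; Transfer of E1–E5 to `a₃ = 0` needs semi-ordinary
  families on `U(3,1)` — IDEA-NEEDED, node card §C₀).
* `TwinAlgMuZeroAtThree_of : S_E → C₀′ → crux` — kernel-checked, concludes the crux BY NAME; `sorry` only in the two `stub_*`.
-/

noncomputable section

open scoped Classical NumberField

set_option linter.dupNamespace false
set_option autoImplicit false

namespace Summit.BirchSwinnertonDyer.BirchSwinnertonDyer.Cruxes.TwinAlgMuZeroAtThree.SchurPromodularEisensteinRadical

open NumberField IsDedekindDomain Field WeierstrassCurve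
open Literature.NumberTheory.EllipticCurves Literature.NumberTheory.EllipticCurves.IwasawaAlgebra
open Literature.NumberTheory.EllipticCurves.ZpExtension
open Summit.BirchSwinnertonDyer.Rank1Residual.X11b Summit.BirchSwinnertonDyer.Rank1Residual.X11b.AcSelmer
open Summit.BirchSwinnertonDyer.BirchSwinnertonDyer.Theorems
open Literature.NumberTheory.EllipticCurves.ModularForms (ModularParametrizationData)

/-! ## §1 The pure-algebra leaf A: a `3`-free annihilator forces torsion and `μ = 0` -/

/-- **A (WEAKER · PROVED)** — annihilator criterion over `Λ = ℤ₃⟦T⟧`: if a finitely generated `Λ`-module `M` is killed by some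
`g ∉ 3Λ`, then `M` is `Λ`-torsion and finitely generated over `ℤ₃` (= algebraic `μ = 0`).  Proof: `g ≠ 0` gives torsion (`Λ` is a
domain); `M_{(3)} = 0` because `g` is a unit at the height-one prime `(3)`, so the local length `μ(M)` vanishes, and the tree's
`μ = 0 ⟺ f.g. over ℤ₃` closes.  This is the receptacle through which an EISENSTEIN/congruence ideal bound `Ann_Λ(X) ∋ g` is read.
[cite: Washington1997, §13.2 (structure theory; `μ = 0` iff no `Λ/(p^m)` factor)] [cite: GreenbergVatsal2000, §2 Prop. (2.8) (shape `μ = 0 ⟺` f.g. over `ℤ_p`)] -/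
theorem isTorsion_and_moduleFinite_of_isTorsionBy_of_not_mem_augIdealP
    (M : Type) [AddCommGroup M] [Module (IwasawaAlgebra 3) M] [Module.Finite (IwasawaAlgebra 3) M]
    {g : IwasawaAlgebra 3} (hg : g ∉ augIdealP 3) (hby : Module.IsTorsionBy (IwasawaAlgebra 3) M g) :
    Module.IsTorsion (IwasawaAlgebra 3) M ∧
      Module.Finite ℤ_[3] (RestrictScalars ℤ_[3] (IwasawaAlgebra 3) M) := by
  have hg0 : g ≠ 0 := by
    rintro rfl
    exact hg (Ideal.zero_mem _)
  have hT : Module.IsTorsion (IwasawaAlgebra 3) M := fun x =>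
    ⟨⟨g, mem_nonZeroDivisors_of_ne_zero hg0⟩, @hby x⟩
  let 𝔭 : PrimeSpectrum (IwasawaAlgebra 3) := ⟨augIdealP 3, isPrime_augIdealP_holds 3⟩
  have hμ : muInvariant 3 M = 0 := by
    rw [muInvariant_eq_toNat_lengthAt 3 M 𝔭 rfl,
      Literature.NumberTheory.EllipticCurves.Module.lengthAt_eq_zero_of_isTorsionBy hby 𝔭 hg]
    rfl
  exact ⟨hT, (muInvariant_eq_zero_iff_holds 3 M hT).mp hμ⟩

/-- **A′ (WEAKER · PROVED)** — the converse bookkeeping: a `Λ`-module finitely generated over `ℤ₃` is killed by a `3`-free element,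
namely `P(T)` for a monic `P ∈ ℤ₃[X]` with `P(T)·M = 0` (Cayley–Hamilton for the `ℤ₃`-linear endomorphism `T`).  So «`3`-free
annihilator» is EXACTLY «torsion ∧ `μ = 0`» for finitely generated `Λ`-modules — the EQUIV tag of S_E. [folklore; Cayley–Hamilton]
[cite: Washington1997, §13.2] -/
theorem exists_isTorsionBy_not_mem_augIdealP_of_moduleFinite_padicInt
    (M : Type) [AddCommGroup M] [Module (IwasawaAlgebra 3) M]
    (hfg : Module.Finite ℤ_[3] (RestrictScalars ℤ_[3] (IwasawaAlgebra 3) M)) :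
    ∃ g : IwasawaAlgebra 3, g ∉ augIdealP 3 ∧ Module.IsTorsionBy (IwasawaAlgebra 3) M g := by
  -- the `ℤ₃`-module structure on `M` through `ℤ₃ → Λ` (definitionally the one of `RestrictScalars ℤ₃ Λ M`)
  letI : Module ℤ_[3] M := Module.compHom M (algebraMap ℤ_[3] (IwasawaAlgebra 3))
  haveI : IsScalarTower ℤ_[3] (IwasawaAlgebra 3) M := IsScalarTower.of_compHom ℤ_[3] _ M
  haveI : Module.Finite ℤ_[3] M := hfg
  -- Cayley–Hamilton for the `ℤ₃`-linear endomorphism `T • ·` of the finitely generated `ℤ₃`-module `M`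
  obtain ⟨P, hPmonic, hP⟩ := LinearMap.exists_monic_and_aeval_eq_zero ℤ_[3]
    (Algebra.lsmul ℤ_[3] ℤ_[3] M (PowerSeries.X : IwasawaAlgebra 3))
  rw [Polynomial.aeval_algHom_apply] at hP
  -- `P(T)` as a power series is the coercion of the polynomial `P`
  have hcoe : Polynomial.aeval (PowerSeries.X : IwasawaAlgebra 3) P = (P : PowerSeries ℤ_[3]) := by
    rw [Polynomial.aeval_def, PowerSeries.algebraMap_eq, Polynomial.eval₂_C_X_eq_coe]
  refine ⟨Polynomial.aeval (PowerSeries.X : IwasawaAlgebra 3) P, ?_, ?_⟩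
  · -- the top coefficient of `P(T)` is `1`, so `3 ∤ P(T)` in `Λ`
    intro hmem
    rw [augIdealP, Ideal.mem_span_singleton,
      Literature.NumberTheory.EllipticCurves.PowerSeries.C_dvd_iff_forall_dvd_coeff] at hmem
    have h1 := hmem P.natDegree
    rw [hcoe, Polynomial.coeff_coe, hPmonic.coeff_natDegree] at h1
    exact PadicInt.irreducible_p.not_isUnit (isUnit_of_dvd_one h1)
  · -- `P(T) • x = (P(T•))(x) = 0`
    intro x
    have happ := LinearMap.congr_fun hP x
    simpa [Algebra.lsmul_coe] using happ

/-! ## §2 The bucket-B piece S_E in annihilator currency -/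

/-- **S_E `EisensteinAnnihilatorMultOfParamAtThree`** — bucket B of crux 24737 in ANNIHILATOR CURRENCY: for every twin `W′/ℚ`
multiplicative and très ramifié at `3` (`3 ∤ v₃(Δ′)`) with `ρ̄₃` onto and conductor `N′`, GIVEN a modular parametrisation datum `Dt′`,
every imaginary quadratic `K` Heegner for `N′` with odd `d_K`, every anticyclotomic `κ` with topological generator `γ`, `𝔭 ∋ 3` of
degree one and `𝔭′ ∋ 3`, `𝔭′ ≠ 𝔭`: SOME `3`-FREE ELEMENT `g ∈ Λ` (`g ∉ 3Λ`) ANNIHILATES Castella's compact `(∅,0)` Selmer module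
`X_(∅,0)(E′/K_∞)` at `𝔭′`.  The line intends `g =` a power of a generator of the height-one part of the stable congruence ideal `J^st`
of the endoscopic eigensystem of `(f_{E′}, K)` on `U(3,1)` (E1), placed in `√Ann(X)` by Schur pro-modularity (E2) + GMA exhaustion (E3)
fed with the torsion conjunct (E4), and `3`-free by E5.  UNDECIDED · EQUIV to the B-half of the crux (`eisensteinAnnihilator_of_crux`,
`TwinAlgMuZeroAtThree_of`).  A `Prop` only; nothing is asserted.
[cite: Thorne2015JAMS, Thm. 7.1] [cite: AllenNewtonThorne2020, Thm. 1.1] [cite: SkinnerWiles1999, §1] [cite: BellaicheChenevier2009, Thm. 1.5.5]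
[cite: Wan2020, Thm. 1.1] [cite: Hsieh2014, Thm. B] -/
@[conjecture]
def EisensteinAnnihilatorMultOfParamAtThree : Prop :=
    ∀ (W' : WeierstrassCurve ℚ) [W'.IsElliptic] [W'.IsGloballyMinimal] (N' : ℕ) [NeZero N']
      (K : Type) [Field K] [NumberField K] (_Dt' : ModularParametrizationData W' N'),
      Rank1Residual.Mult W' 3 → ¬ 3 ∣ padicValInt 3 W'.minimalDiscriminantInt →
      W'.HasSurjectiveModNGaloisRep 3 → W'.conductorNorm ℤ = N' → IsImaginaryQuadratic K →
      SatisfiesHeegnerHypothesis N' K → Odd (NumberField.discr K) →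
      ∀ (κ : ZpExtension K 3), κ.IsAnticyclotomic →
      ∀ (γ : absoluteGaloisGroup K) [Fact (κ.IsTopGenerator γ)]
        (𝔭 : HeightOneSpectrum (𝓞 K)), ((3 : ℕ) : 𝓞 K) ∈ 𝔭.asIdeal →
        𝔭.asIdeal.ramificationIdx (𝓞 ℚ) = 1 → 𝔭.asIdeal.inertiaDeg (𝓞 ℚ) = 1 →
      ∀ (𝔭' : HeightOneSpectrum (𝓞 K)), ((3 : ℕ) : 𝓞 K) ∈ 𝔭'.asIdeal → 𝔭' ≠ 𝔭 →
      ∃ g : IwasawaAlgebra 3, g ∉ augIdealP 3 ∧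
        Module.IsTorsionBy (IwasawaAlgebra 3) (XAc (W'.baseChange K) 3 κ 𝔭' ∅ γ) g

/-! ## §3 Evidence for the tags (no `sorry`): S_E ⟸ crux, S_E ⟸ K1‴ ∧ K2a‴ -/

/-- **crux ⟹ S_E** (so S_E is a CONSEQUENCE of the crux; with the B-branch of `TwinAlgMuZeroAtThree_of` this makes S_E EQUIV to the
bucket-B half): torsion ∧ a generator of `Ch·R₀⟦T⟧` with a norm-one coefficient ⟹ `Sel[3]` finite ⟹ `X` f.g. over `ℤ₃` (route receptacle)
⟹ a `3`-free annihilator (A′). [cite: Washington1997, §13.2] -/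
theorem eisensteinAnnihilator_of_crux
    (h : Summit.BirchSwinnertonDyer.BirchSwinnertonDyer.Theses.UniversalToricDescent.TwinAlgMuZeroAtThree) :
    EisensteinAnnihilatorMultOfParamAtThree := by
  intro W' _ _ N' _ K _ _ Dt' hm htr hsurj hN hK hH hodd κ hκ γ _ 𝔭 h𝔭 he hf 𝔭' h𝔭' hne
  obtain ⟨htors, g, hg, hi⟩ := h W' N' K Dt' (Or.inl ⟨hm, htr⟩) hsurj hN hK hH hodd κ hκ γ 𝔭 h𝔭 he hf 𝔭' h𝔭' hne
  exact exists_isTorsionBy_not_mem_augIdealP_of_moduleFinite_padicInt _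
    (UniversalToricDescentAcDualMuZero.moduleFinite_padicInt_of_finite_pTorsion (W'.baseChange K) 3 κ 𝔭' ∅ γ Set.finite_empty
      (UniversalToricDescentAcDualMuZero.finite_pTorsion_of_isTorsion_of_exists_generator (W'.baseChange K) 3 κ 𝔭' ∅ γ
        Set.finite_empty htors ⟨g, hg, hi⟩))

/-- **K1‴ ∧ K2a‴ ⟹ S_E** (so S_E is no stronger than what line `beta-road` v19 already asks for bucket B). [cite: Howard2004HeegnerKolyvagin, Thm. 2.3.1 (shape only)] -/
theorem eisensteinAnnihilator_of_betaRoad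
    (hK1 : UniversalToricDescentBetaRoadParamDefs.PrincipalHeegnerIndivisibleMultOfParamAtThree)
    (hK2 : UniversalToricDescentKsTwinLambdaDefs.KsTwinLambdaAdicAtThree) :
    EisensteinAnnihilatorMultOfParamAtThree := by
  intro W' _ _ N' _ K _ _ Dt' hm htr hsurj hN hK hH hodd κ hκ γ _ 𝔭 h𝔭 he hf 𝔭' h𝔭' hne
  obtain ⟨htors, g, hg, hμ⟩ :=
    UniversalToricDescentTwinAlgMuZeroAtThreeOfBetaRoadParam.twinAlgMuZeroAtThree_mult_of_betaRoadParam hK1 hK2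
      W' N' K Dt' hm htr hsurj hN hK hH hodd κ hκ γ 𝔭 h𝔭 he hf 𝔭' h𝔭' hne
  exact exists_isTorsionBy_not_mem_augIdealP_of_moduleFinite_padicInt _
    (UniversalToricDescentAcDualMuZero.moduleFinite_padicInt_of_finite_pTorsion (W'.baseChange K) 3 κ 𝔭' ∅ γ Set.finite_empty
      (UniversalToricDescentAcDualMuZero.finite_pTorsion_of_isTorsion_of_exists_generator (W'.baseChange K) 3 κ 𝔭' ∅ γ
        Set.finite_empty htors ⟨g, hg, hμ⟩))

/-! ## §4 The two stubs of the node (the ONLY `sorry`s of this file) -/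

/-- **stub S_E** (`EisensteinAnnihilatorMultOfParamAtThree`) — UNDECIDED; research; children E1 (`Λ^ac`-adic endoscopic eigensystem and
congruence ideal on `U(3,1)` at `p = 3`, `E′` Steinberg), E2 (Schur pro-modularity at `l = 3` with torsion replacing Steinberg — the
lever; print wall `l > 3`), E3 (exhaustion ⟹ radical annihilation), E4 (torsion conjunct), E5 (`J^st ⊄ 3Λ`) — see
`Lines/schur_promodular_eisenstein_radical.md`. [cite: Thorne2015JAMS, Thm. 7.1] [cite: AllenNewtonThorne2020, Thm. 1.1]
[cite: Wan2020, Thm. 1.1] [cite: Hsieh2014, Thm. B] -/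
theorem stub_eisensteinAnnihilatorMult : EisensteinAnnihilatorMultOfParamAtThree := by
  sorry

/-- **stub C₀′** — the registered good-supersingular constant of line `beta-road` v19 BY NAME (untouched by this line). -/
theorem stub_goodSS : UniversalToricDescentBetaRoadParamDefs.TwinAlgMuZeroAtThreeGoodSSOfParam := by
  sorry

/-! ## §5 Composition: the crux BY NAME -/

/-- **Crux 24737 `TwinAlgMuZeroAtThree` BY NAME from S_E and C₀′**: split the bucket disjunction; on B apply S_E, lemma A
(`3`-free annihilator ⟹ torsion ∧ f.g. over `ℤ₃`) and the route's receptacle (`X` f.g. over `ℤ₃` ⟹ `Sel[3]` finite ⟹ torsion ∧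
`Ch·R₀⟦T⟧ = (g′)` with a norm-one coefficient, landed in `UniversalToricDescentAcDualMuZeroCriterion`); on C₀ apply C₀′.
Kernel-checked; no `sorry`. [cite: GreenbergVatsal2000, §2 Prop. (2.8)] [cite: Washington1997, §13.2] -/
theorem TwinAlgMuZeroAtThree_of (hB : EisensteinAnnihilatorMultOfParamAtThree)
    (hC0 : UniversalToricDescentBetaRoadParamDefs.TwinAlgMuZeroAtThreeGoodSSOfParam) :
    Summit.BirchSwinnertonDyer.BirchSwinnertonDyer.Theses.UniversalToricDescent.TwinAlgMuZeroAtThree := by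
  intro W' _ _ N' _ K _ _ Dt' hbucket hsurj hN hK hH hodd κ hκ γ _ 𝔭 h𝔭 he hf 𝔭' h𝔭' hne
  rcases hbucket with ⟨hm, htr⟩ | ⟨hss, ha⟩
  · obtain ⟨g, hg, hby⟩ := hB W' N' K Dt' hm htr hsurj hN hK hH hodd κ hκ γ 𝔭 h𝔭 he hf 𝔭' h𝔭' hne
    haveI := XAc.module_finite κ 𝔭' ∅ γ Set.finite_empty (W := W'.baseChange K)
    have hfg := (isTorsion_and_moduleFinite_of_isTorsionBy_of_not_mem_augIdealP
      (XAc (W'.baseChange K) 3 κ 𝔭' ∅ γ) hg hby).2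
    exact UniversalToricDescentAcDualMuZero.isTorsion_and_exists_generator_of_finite_pTorsion (W'.baseChange K) 3 κ 𝔭' ∅ γ
      Set.finite_empty
      (UniversalToricDescentAcDualMuZero.finite_pTorsion_of_moduleFinite_padicInt (W'.baseChange K) 3 κ 𝔭' ∅ γ hfg)
  · exact (UniversalToricDescentBetaRoadParamDefs.twinAlgMuZeroAtThreeGoodSSOfParam_iff.mp hC0)
      W' N' K Dt' hss ha hsurj hN hK hH hodd κ hκ γ 𝔭 h𝔭 he hf 𝔭' h𝔭' hne

/-- **The node closes the crux from its two stubs** (= `TwinAlgMuZeroAtThree_of stub_eisensteinAnnihilatorMult stub_goodSS`; inherits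
their `sorry`s). -/
theorem TwinAlgMuZeroAtThree_of_stubs :
    Summit.BirchSwinnertonDyer.BirchSwinnertonDyer.Theses.UniversalToricDescent.TwinAlgMuZeroAtThree :=
  TwinAlgMuZeroAtThree_of stub_eisensteinAnnihilatorMult stub_goodSS

/-- **And the line of record feeds this node**: K1‴ ∧ K2a‴ ∧ C₀′ ⟹ crux through S_E (sanity: the node is a re-cut, not a strengthening). -/
theorem TwinAlgMuZeroAtThree_of_betaRoad_via_annihilator
    (hK1 : UniversalToricDescentBetaRoadParamDefs.PrincipalHeegnerIndivisibleMultOfParamAtThree)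
    (hK2 : UniversalToricDescentKsTwinLambdaDefs.KsTwinLambdaAdicAtThree)
    (hC0 : UniversalToricDescentBetaRoadParamDefs.TwinAlgMuZeroAtThreeGoodSSOfParam) :
    Summit.BirchSwinnertonDyer.BirchSwinnertonDyer.Theses.UniversalToricDescent.TwinAlgMuZeroAtThree :=
  TwinAlgMuZeroAtThree_of (eisensteinAnnihilator_of_betaRoad hK1 hK2) hC0

end Summit.BirchSwinnertonDyer.BirchSwinnertonDyer.Cruxes.TwinAlgMuZeroAtThree.SchurPromodularEisensteinRadical
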